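import Summits.QuantumAdvantage.AdviceFreeQNC0.OddPrimeStatements
import Literature.Computability.MetaComplexity.RazborovSmolenskyPoly
import Mathlib.FieldTheory.Finite.Basic
import HarnessLib

/-!
# Cell qa-qnc0 (odd primes, ROUND-12 §B.5): the two WITNESSES — `ChargeTriple` and `WalkEasyThree`
# (hence `¬ WalkHardF 3`)

Statements: `OddPrimeStatements.lean` (planner qa-qnc0-p2's Sketch12b §§7–8 VERBATIM, landed by seat
qn-prover-3).  PROVED here:

* `chargeTriple : ChargeTriple` — each cut `g` is off-support (`c + ρ + g + e_g(u) ≡ 0 (3)`) for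
  exactly one of the three charges `c + ρ`, `ρ ∈ ℤ/3`, so the three counted sets have total size
  `2·#{g : y_g(u) = 1}` (double counting) and at most two of the three counts are odd: averaged over
  the charge NO strategy of any complexity beats `2/3` in the u-walk game.
* `walkEasyThree : WalkEasyThree` — at `p = 3` the strategy `y₀ = [(c + wt u) % 3 ≠ 0] = (c + Σuᵢ)²`,
  `y₁ = ¬y₀ = 1 − (c + Σuᵢ)²`, `y_g = 0` (`g ≥ 2`) has `𝔽₃`-degree `2` and wins on EVERY `u` (cut `0`
  reads `c + wt u`, cut `1` reads `c + 1 + wt u + [u₀]`, so exactly one counted output);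
  `not_walkHardF_three : ¬ WalkHardF 3` — the u-walk game is NOT hard over `𝔽₃`: for `p = 3` the ring
  relation is protected by the parity chart, not by the walk (ROUND-12 §B.5), so the odd-prime programme
  splits into `p ≥ 5` (crux `WalkHardF p`) and `p = 3` (x-coordinates, `RingHardOdd 3`).

WHAT THIS IS NOT: nothing on `WalkHardF p` for `p ≥ 5` (OPEN, missing lemma M2) or on `p = 2` (that is
α, `WalkHardAll`, PROVED elsewhere); separation NOT moved.
-/

noncomputable section

namespace Summit.QuantumAdvantage.AdviceFreeQNC0

open Classical
open Finset
open Literature.Computability.QuantumComplexity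
open Literature.Computability.MetaComplexity Literature.Computability.MetaComplexity.Smolensky

/-! ### `ChargeTriple` -/

/-- For every `m`, exactly two of the three residues `ρ` have `(m + ρ) % 3 ≠ 0`. -/
private theorem card_charges_ne_zero (m : ℕ) :
    (univ.filter fun ρ : Fin 3 => (m + ρ.val) % 3 ≠ 0).card = 2 := by
  have hr : m % 3 < 3 := Nat.mod_lt _ (by norm_num)
  have key : ∀ r : ℕ, r < 3 → (univ.filter fun ρ : Fin 3 => (r + ρ.val) % 3 ≠ 0).card = 2 := by
    intro r hr
    interval_cases r <;> decide
  have hfe : (univ.filter fun ρ : Fin 3 => (m + ρ.val) % 3 ≠ 0) =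
      univ.filter fun ρ : Fin 3 => (m % 3 + ρ.val) % 3 ≠ 0 := by
    ext ρ
    simp only [mem_filter, mem_univ, true_and]
    constructor <;> intro h <;> omega
  rw [hfe]
  exact key (m % 3) hr

/-- **`ChargeTriple`**: at most two of the three charges `c, c+1, c+2` are won on any `(y, u)`. -/
theorem chargeTriple : ChargeTriple := by
  intro n c y u
  -- the three counted sets
  set S : Fin 3 → Finset (Fin (n + 1)) := fun ρ => univ.filter fun g : Fin (n + 1) =>
    y g u = true ∧ (c + ρ.val + g.val + walkExp u g.val) % 3 ≠ 0 with hS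
  have hwin : ∀ ρ : Fin 3, ringWinU (c + ρ.val) y u = true → (S ρ).card % 2 = 1 := by
    intro ρ h
    simpa only [ringWinU, hS, decide_eq_true_eq] using h
  -- double counting: `Σ_ρ #S_ρ = 2 · #{g : y_g(u) = 1}`
  have hsum : ∑ ρ : Fin 3, (S ρ).card =
      2 * (univ.filter fun g : Fin (n + 1) => y g u = true).card := by
    have h1 : ∀ ρ : Fin 3, (S ρ).card = ∑ g : Fin (n + 1),
        (if y g u = true ∧ (c + ρ.val + g.val + walkExp u g.val) % 3 ≠ 0 then 1 else 0) := by
      intro ρ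
      exact Finset.card_filter _ _
    simp_rw [h1]
    rw [Finset.sum_comm, Finset.card_filter, Finset.mul_sum]
    refine Finset.sum_congr rfl fun g _ => ?_
    by_cases hy : y g u = true
    · simp only [hy, true_and, if_true, mul_one]
      have hcf := Finset.card_filter
        (fun ρ : Fin 3 => (c + ρ.val + g.val + walkExp u g.val) % 3 ≠ 0) univ
      rw [← hcf]
      have hfe : (univ.filter fun ρ : Fin 3 => (c + ρ.val + g.val + walkExp u g.val) % 3 ≠ 0) =
          univ.filter fun ρ : Fin 3 => ((c + g.val + walkExp u g.val) + ρ.val) % 3 ≠ 0 := by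
        ext ρ
        simp only [mem_filter, mem_univ, true_and]
        constructor <;> intro h <;> omega
      rw [hfe]
      exact card_charges_ne_zero _
    · simp [hy]
  -- if all three counts were odd their sum would be odd
  by_contra hgt
  rw [not_le] at hgt
  have huniv : (univ.filter fun ρ : Fin 3 => ringWinU (c + ρ.val) y u = true) = univ := by
    apply Finset.eq_univ_of_card
    have := Finset.card_le_univ (univ.filter fun ρ : Fin 3 => ringWinU (c + ρ.val) y u = true)
    rw [Fintype.card_fin] at this ⊢
    omega
  have hall : ∀ ρ : Fin 3, (S ρ).card % 2 = 1 := by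
    intro ρ
    have hρ : ρ ∈ (univ.filter fun ρ : Fin 3 => ringWinU (c + ρ.val) y u = true) := by
      rw [huniv]; exact mem_univ _
    rw [mem_filter] at hρ
    exact hwin ρ hρ.2
  have h0 := hall 0
  have h1 := hall 1
  have h2 := hall 2
  have hs : ∑ ρ : Fin 3, (S ρ).card = (S 0).card + (S 1).card + (S 2).card := Fin.sum_univ_three _
  omega

/-! ### `WalkEasyThree` and `¬ WalkHardF 3` -/

variable {n : ℕ}

/-- `W_0 = 0`. -/
private theorem wtPrefix_at_zero (u : Fin n → Bool) : wtPrefix u 0 = 0 := by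
  unfold wtPrefix
  simp

/-- `W_1 ≤ 1`. -/
private theorem wtPrefix_at_one_le (u : Fin n → Bool) : wtPrefix u 1 ≤ 1 := by
  unfold wtPrefix
  refine le_trans (Finset.card_le_card (fun i hi => ?_ : _ ⊆ univ.filter fun i : Fin n => i.val < 1))
    ?_
  · rw [mem_filter] at hi ⊢
    exact ⟨hi.1, hi.2.1⟩
  · refine Finset.card_le_one.2 fun a ha b hb => ?_
    rw [mem_filter] at ha hb
    exact Fin.ext (by omega)

/-- The linear form `u ↦ c + Σ uᵢ` over any field has degree `≤ 1`. -/
private theorem linForm_mem_lowDeg (F : Type*) [Field F] (c : ℕ) :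
    (fun u : Fin n → Bool => ((c + wt u : ℕ) : F)) ∈ lowDeg F n 1 := by
  have heq : (fun u : Fin n → Bool => ((c + wt u : ℕ) : F)) =
      (c : F) • (1 : CubeFn F n) + ∑ i : Fin n, mono F {i} := by
    funext u
    simp only [Pi.add_apply, Pi.smul_apply, Pi.one_apply, smul_eq_mul, mul_one, Finset.sum_apply,
      mono_apply, Finset.mem_singleton, forall_eq, Nat.cast_add]
    congr 1
    unfold wt
    rw [Finset.card_filter]
    push_cast
    rfl
  rw [heq]
  refine Submodule.add_mem _ (Submodule.smul_mem _ _ (one_mem_lowDeg 1)) ?_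
  exact Submodule.sum_mem _ fun i _ => mono_mem_lowDeg (by simp)

/-- In `𝔽₃`: `(c + wt u)² = [(c + wt u) % 3 ≠ 0]`. -/
private theorem linForm_sq_apply (c : ℕ) (u : Fin n → Bool) :
    ((c + wt u : ℕ) : ZMod 3) ^ 2 = if (c + wt u) % 3 ≠ 0 then 1 else 0 := by
  by_cases h : (c + wt u) % 3 ≠ 0
  · rw [if_pos h]
    have hne : ((c + wt u : ℕ) : ZMod 3) ≠ 0 := by
      rw [Ne, ZMod.natCast_eq_zero_iff]
      rintro ⟨k, hk⟩
      omega
    exact ZMod.pow_card_sub_one_eq_one hne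
  · rw [if_neg h]
    rw [not_not] at h
    have h0 : ((c + wt u : ℕ) : ZMod 3) = 0 := by
      rw [ZMod.natCast_eq_zero_iff]
      exact Nat.dvd_of_mod_eq_zero h
    rw [h0]
    norm_num

/-- **`WalkEasyThree`**: at `p = 3` the u-game is won everywhere by a degree-`2` strategy. -/
theorem walkEasyThree : WalkEasyThree := by
  intro c n hn
  -- the strategy
  refine ⟨fun g u => if g.val = 0 then decide ((c + wt u) % 3 ≠ 0)
      else if g.val = 1 then decide ((c + wt u) % 3 = 0) else false, ?_, ?_⟩
  · -- degrees
    intro g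
    unfold HasDegF
    have hL2 : (fun u : Fin n → Bool => ((c + wt u : ℕ) : ZMod 3)) ^ 2 ∈ lowDeg (ZMod 3) n 2 := by
      simpa using pow_mem_lowDeg (linForm_mem_lowDeg (ZMod 3) c) 2
    by_cases hg0 : g.val = 0
    · have heq : (fun u : Fin n → Bool => if (if g.val = 0 then decide ((c + wt u) % 3 ≠ 0)
            else if g.val = 1 then decide ((c + wt u) % 3 = 0) else false) = true
            then (1 : ZMod 3) else 0) =
          (fun u : Fin n → Bool => ((c + wt u : ℕ) : ZMod 3)) ^ 2 := by
        funext u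
        rw [Pi.pow_apply, linForm_sq_apply]
        simp only [hg0, if_true, decide_eq_true_eq]
      rw [heq]
      exact hL2
    · by_cases hg1 : g.val = 1
      · have heq : (fun u : Fin n → Bool => if (if g.val = 0 then decide ((c + wt u) % 3 ≠ 0)
              else if g.val = 1 then decide ((c + wt u) % 3 = 0) else false) = true
              then (1 : ZMod 3) else 0) =
            1 - (fun u : Fin n → Bool => ((c + wt u : ℕ) : ZMod 3)) ^ 2 := by
          funext u
          rw [Pi.sub_apply, Pi.one_apply, Pi.pow_apply, linForm_sq_apply]
          by_cases h : (c + wt u) % 3 = 0 <;> simp [hg1, h]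
        rw [heq]
        exact Submodule.sub_mem _ (one_mem_lowDeg 2) hL2
      · have heq : (fun u : Fin n → Bool => if (if g.val = 0 then decide ((c + wt u) % 3 ≠ 0)
              else if g.val = 1 then decide ((c + wt u) % 3 = 0) else false) = true
              then (1 : ZMod 3) else 0) = 0 := by
          funext u
          simp [hg0, hg1]
        rw [heq]
        exact Submodule.zero_mem _
  · -- the strategy wins everywhere: exactly one counted output
    intro u
    unfold ringWinU
    rw [decide_eq_true_eq]
    set g₀ : Fin (n + 1) := ⟨if (c + wt u) % 3 ≠ 0 then 0 else 1, by split_ifs <;> omega⟩ with hg₀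
    have hset : (univ.filter fun g : Fin (n + 1) =>
        (if g.val = 0 then decide ((c + wt u) % 3 ≠ 0)
          else if g.val = 1 then decide ((c + wt u) % 3 = 0) else false) = true ∧
          (c + g.val + walkExp u g.val) % 3 ≠ 0) = {g₀} := by
      ext g
      simp only [mem_filter, mem_univ, true_and, mem_singleton]
      have hW1 := wtPrefix_at_one_le u
      constructor
      · rintro ⟨hy, _⟩
        apply Fin.ext
        rw [hg₀]
        by_cases h0 : g.val = 0
        · simp only [h0, if_true, decide_eq_true_eq] at hy
          simp [h0, hy]
        · by_cases h1 : g.val = 1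
          · simp [h1] at hy
            simp [h1, hy]
          · simp [h0, h1] at hy
      · intro hg
        subst hg
        by_cases h : (c + wt u) % 3 ≠ 0
        · have hv : g₀.val = 0 := by rw [hg₀]; simp [h]
          refine ⟨by simp [hv, h], ?_⟩
          rw [hv, walkExp, wtPrefix_at_zero]
          simpa using h
        · have hv : g₀.val = 1 := by rw [hg₀]; simp [h]
          rw [not_not] at h
          refine ⟨by simp [hv, h], ?_⟩
          rw [hv, walkExp]
          omega
    rw [hset, card_singleton]

/-- **`¬ WalkHardF 3`**: for `p = 3` the u-walk game is easy (the protection of the ring relation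
is the parity chart, not the walk). -/
theorem not_walkHardF_three : ¬ WalkHardF 3 := by
  rintro ⟨θ, hθ, h⟩
  obtain ⟨n₀, hn₀⟩ := h 1
  set n := max n₀ 4 with hn
  obtain ⟨y, hdeg, hwin⟩ := walkEasyThree 0 n (by omega)
  have hlog : 2 ≤ Nat.log 2 n := Nat.le_log_of_pow_le (by norm_num) (by omega)
  have hdeg' : ∀ g, HasDegF 3 (y g) ((Nat.log 2 n) ^ 1) := fun g =>
    lowDeg_mono (by rw [pow_one]; exact hlog) (hdeg g)
  have hb := hn₀ n (le_max_left _ _) 0 y hdeg'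
  have hall : (univ.filter fun u : Fin n → Bool => ringWinU 0 y u = true) = univ :=
    Finset.filter_true_of_mem fun u _ => hwin u
  rw [hall, card_univ, Fintype.card_fun, Fintype.card_bool, Fintype.card_fin] at hb
  push_cast at hb
  have hpos : (0 : ℝ) < (2 : ℝ) ^ n := by positivity
  nlinarith


/-! ### The `p = 3` strategy is ONE-shot (sharpness of the two-shot hardness theorem in `p`) -/

/-- The winning `𝔽₃`-strategy of `walkEasyThree` fires AT MOST ONE cut on every input (exactly
one of the cuts `0`, `1`): so at `p = 3` even ONE-shot strategies of degree `2` win everywhere — the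
hypothesis `p ≠ 3` of the two-shot hardness theorem (`TwoShotHard.lean`) is necessary. -/
theorem walkEasyThree_oneShot (c n : ℕ) (hn : 1 ≤ n) :
    ∃ y : Fin (n + 1) → (Fin n → Bool) → Bool,
      (∀ g, HasDegF 3 (y g) 2) ∧
      (∀ u, (univ.filter fun g : Fin (n + 1) => y g u = true).card ≤ 1) ∧
      ∀ u : Fin n → Bool, ringWinU c y u = true := by
  -- the strategy of `walkEasyThree`
  refine ⟨fun g u => if g.val = 0 then decide ((c + wt u) % 3 ≠ 0)
      else if g.val = 1 then decide ((c + wt u) % 3 = 0) else false, ?_, ?_, ?_⟩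
  · -- degrees
    intro g
    unfold HasDegF
    have hL2 : (fun u : Fin n → Bool => ((c + wt u : ℕ) : ZMod 3)) ^ 2 ∈ lowDeg (ZMod 3) n 2 := by
      simpa using pow_mem_lowDeg (linForm_mem_lowDeg (ZMod 3) c) 2
    by_cases hg0 : g.val = 0
    · have heq : (fun u : Fin n → Bool => if (if g.val = 0 then decide ((c + wt u) % 3 ≠ 0)
            else if g.val = 1 then decide ((c + wt u) % 3 = 0) else false) = true
            then (1 : ZMod 3) else 0) =
          (fun u : Fin n → Bool => ((c + wt u : ℕ) : ZMod 3)) ^ 2 := by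
        funext u
        rw [Pi.pow_apply, linForm_sq_apply]
        simp only [hg0, if_true, decide_eq_true_eq]
      rw [heq]
      exact hL2
    · by_cases hg1 : g.val = 1
      · have heq : (fun u : Fin n → Bool => if (if g.val = 0 then decide ((c + wt u) % 3 ≠ 0)
              else if g.val = 1 then decide ((c + wt u) % 3 = 0) else false) = true
              then (1 : ZMod 3) else 0) =
            1 - (fun u : Fin n → Bool => ((c + wt u : ℕ) : ZMod 3)) ^ 2 := by
          funext u
          rw [Pi.sub_apply, Pi.one_apply, Pi.pow_apply, linForm_sq_apply]
          by_cases h : (c + wt u) % 3 = 0 <;> simp [hg1, h]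
        rw [heq]
        exact Submodule.sub_mem _ (one_mem_lowDeg 2) hL2
      · have heq : (fun u : Fin n → Bool => if (if g.val = 0 then decide ((c + wt u) % 3 ≠ 0)
              else if g.val = 1 then decide ((c + wt u) % 3 = 0) else false) = true
              then (1 : ZMod 3) else 0) = 0 := by
          funext u
          simp [hg0, hg1]
        rw [heq]
        exact Submodule.zero_mem _
  · -- at most one shot: a firing cut has value `[(c + wt u) % 3 = 0]`
    intro u
    refine Finset.card_le_one.2 fun a ha b hb => ?_
    rw [mem_filter] at ha hb
    have hval : ∀ g : Fin (n + 1), (if g.val = 0 then decide ((c + wt u) % 3 ≠ 0)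
        else if g.val = 1 then decide ((c + wt u) % 3 = 0) else false) = true →
        g.val = if (c + wt u) % 3 ≠ 0 then 0 else 1 := by
      intro g hy
      by_cases h0 : g.val = 0
      · simp only [h0, if_true, decide_eq_true_eq] at hy
        simp [h0, hy]
      · by_cases h1 : g.val = 1
        · simp [h1] at hy
          simp [h1, hy]
        · simp [h0, h1] at hy
    exact Fin.ext ((hval a ha.2).trans (hval b hb.2).symm)
  · -- the strategy wins everywhere: exactly one counted output
    intro u
    unfold ringWinU
    rw [decide_eq_true_eq]
    set g₀ : Fin (n + 1) := ⟨if (c + wt u) % 3 ≠ 0 then 0 else 1, by split_ifs <;> omega⟩ with hg₀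
    have hset : (univ.filter fun g : Fin (n + 1) =>
        (if g.val = 0 then decide ((c + wt u) % 3 ≠ 0)
          else if g.val = 1 then decide ((c + wt u) % 3 = 0) else false) = true ∧
          (c + g.val + walkExp u g.val) % 3 ≠ 0) = {g₀} := by
      ext g
      simp only [mem_filter, mem_univ, true_and, mem_singleton]
      have hW1 := wtPrefix_at_one_le u
      constructor
      · rintro ⟨hy, _⟩
        apply Fin.ext
        rw [hg₀]
        by_cases h0 : g.val = 0
        · simp only [h0, if_true, decide_eq_true_eq] at hy
          simp [h0, hy]
        · by_cases h1 : g.val = 1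
          · simp [h1] at hy
            simp [h1, hy]
          · simp [h0, h1] at hy
      · intro hg
        subst hg
        by_cases h : (c + wt u) % 3 ≠ 0
        · have hv : g₀.val = 0 := by rw [hg₀]; simp [h]
          refine ⟨by simp [hv, h], ?_⟩
          rw [hv, walkExp, wtPrefix_at_zero]
          simpa using h
        · have hv : g₀.val = 1 := by rw [hg₀]; simp [h]
          rw [not_not] at h
          refine ⟨by simp [hv, h], ?_⟩
          rw [hv, walkExp]
          omega
    rw [hset, card_singleton]

end Summit.QuantumAdvantage.AdviceFreeQNC0

end
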